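import Summits.Ventures.PercRepro.S1SeriesLever

/-!
# PercRepro — THE SERIES-CLASS LEVER WITH EXACT POINT COUNTS (p2, gen 26; SUBCLAIM-S1 §6.10)

`gb d n` (S1SeriesLever) is the iterated series-class lever with `n` a LOWER bound on the non-coloops. With the exact
count the averaged-point case splits by the number `k ≤ 2` of series partners of the averaged point `x`: for
`k ≤ 1` the coloop-free part of `P ＼ x` has exactly `n − 1 − k` points, and for `k = 2` every four-circuit
through `x` is `{x, y, z, w}` (it contains both partners, p7's `insert_coloops_delete_subset_of_fourCircuitThrough`),
so `s₄(x) ≤ n − 3` instead of the average `4·s₄/n`. The recursion `gbR` lowers the lever on the row-9 cells from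
`79 / 120 / 167` to `70 / 100 / 144` at `(9, 8) / (9, 9) / (9, 10)` (exact twin mining/p2/g26/gbR.py).

* `gbR` — the refined recursion (falls back to `gb` below `9` points);
* `ncard_fourCircuitsThrough_le_of_two` — two series partners: at most `n − 3` four-circuits through the point;
* **`ncard_fourCircuits_le_gbR`** — `s₄ ≤ gbR d #(non-coloops)` on every `e`-free core of nullity `d`;
* `ncard_fourCircuits_le_gbR_of_coloopFree`, `gbR_values`.
Axioms: standard.
-/

open scoped Matroid

namespace PercRepro

namespace S1

open Set

variable {α : Type}

/-- **THE REFINED SERIES-CLASS LEVER**: `gbR d n` bounds `s₄` on every `e`-free core of nullity `d` with exactly `n`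
non-coloops — `avgChain16 d` at `d ≤ 4`, `gb d n` below `9` points, else the largest of `avgChain16 (d − 1) + 1`
(a point with `≥ 3` series partners), `⌊n·gbR (d − 1) (n − 1)/(n − 4)⌋` and `⌊n·gbR (d − 1) (n − 2)/(n − 4)⌋`
(the averaged point with `0`, resp. `1`, series partner) and `gbR (d − 1) (n − 3) + (n − 3)` (two series partners). -/
def gbR : ℕ → ℕ → ℕ
  | 0, _ => ThmN.avgChain16 0
  | 1, _ => ThmN.avgChain16 1
  | 2, _ => ThmN.avgChain16 2
  | 3, _ => ThmN.avgChain16 3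
  | 4, _ => ThmN.avgChain16 4
  | d + 5, n => if n < 9 then gb (d + 5) n else
      max (max (ThmN.avgChain16 (d + 4) + 1) (n * gbR (d + 4) (n - 1) / (n - 4)))
        (max (n * gbR (d + 4) (n - 2) / (n - 4)) (gbR (d + 4) (n - 3) + (n - 3)))

/-- `gbR d n = avgChain16 d` for `d ≤ 4`. -/
theorem gbR_of_le_four {d : ℕ} (hd : d ≤ 4) (n : ℕ) : gbR d n = ThmN.avgChain16 d := by
  interval_cases d <;> rfl

/-- The unfolding of `gbR` at nullity `d + 5`. -/
theorem gbR_succ (d n : ℕ) : gbR (d + 5) n = (if n < 9 then gb (d + 5) n else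
    max (max (ThmN.avgChain16 (d + 4) + 1) (n * gbR (d + 4) (n - 1) / (n - 4)))
      (max (n * gbR (d + 4) (n - 2) / (n - 4)) (gbR (d + 4) (n - 3) + (n - 3)))) := rfl

/-- The values on the row-9 cells: `gbR 8 17 = 70`, `gbR 9 18 = 100`, `gbR 10 19 = 144`, `gbR 8 16 = 76`,
`gbR 8 15 = 85`. -/
theorem gbR_values : gbR 8 17 = 70 ∧ gbR 9 18 = 100 ∧ gbR 10 19 = 144 ∧ gbR 8 16 = 76 ∧ gbR 8 15 = 85 := by
  decide

/-- **Two series partners**: on a coloop-free `M`, if `M ＼ x` has exactly two coloops `y, z`, every four-circuit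
through `x` is `{x, y, z, w}`, so there are at most `|E| − 3` of them. -/
theorem ncard_fourCircuitsThrough_le_of_two (M : Matroid α) [M.Finite] (hcol : M.coloops = ∅) (x : α)
    (hxE : x ∈ M.E) (hk : (M ＼ {x}).coloops.ncard = 2) :
    {C : Set α | M.IsCircuit C ∧ C.ncard = 4 ∧ x ∈ C}.ncard ≤ M.E.ncard - 3 := by
  classical
  set K := (M ＼ {x}).coloops with hK
  have hKfin : K.Finite := (M ＼ {x}).ground_finite.subset (M ＼ {x}).coloops_subset_ground
  have hxK : x ∉ K := S2.notMem_coloops_delete M x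
  have hKE : K ⊆ M.E := fun y hy => ((M ＼ {x}).coloops_subset_ground hy).1
  have hIK : (insert x K).ncard = 3 := by rw [Set.ncard_insert_of_notMem hxK hKfin, hk]
  have hIE : insert x K ⊆ M.E := Set.insert_subset hxE hKE
  set T := M.E \ insert x K with hT
  have hTfin : T.Finite := M.ground_finite.subset Set.sdiff_subset
  have hTcard : T.ncard = M.E.ncard - 3 := by
    rw [hT, Set.ncard_sdiff hIE (hKfin.insert x), hIK]
  have hsubC : ∀ C ∈ {C : Set α | M.IsCircuit C ∧ C.ncard = 4 ∧ x ∈ C}, insert x K ⊆ C :=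
    fun C hC => S2.insert_coloops_delete_subset_of_fourCircuitThrough M hcol x hC
  refine (Set.ncard_le_ncard_of_injOn (t := (fun w : α => ({w} : Set α)) '' T) (fun C => C \ insert x K) ?_ ?_
    (hTfin.image _)).trans ?_
  · intro C hC
    have hsub := hsubC C hC
    have h1 : (C \ insert x K).ncard = 1 := by
      rw [Set.ncard_sdiff hsub (hKfin.insert x), hC.2.1, hIK]
    obtain ⟨w, hw⟩ := Set.ncard_eq_one.1 h1
    refine ⟨w, ?_, hw.symm⟩
    have hwC : w ∈ C \ insert x K := by rw [hw]; exact Set.mem_singleton w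
    exact ⟨hC.1.subset_ground hwC.1, hwC.2⟩
  · intro C hC C' hC' heq
    have hsub := hsubC C hC
    have hsub' := hsubC C' hC'
    simp only at heq
    calc C = insert x K ∪ (C \ insert x K) := (Set.union_sdiff_cancel hsub).symm
      _ = insert x K ∪ (C' \ insert x K) := by rw [heq]
      _ = C' := Set.union_sdiff_cancel hsub'
  · rw [Set.ncard_image_of_injective _ Set.singleton_injective, hTcard]

/-- **`s₄ ≤ gbR d #(non-coloops)` on every `e`-free core of nullity `d`.** -/
theorem ncard_fourCircuits_le_gbR (d : ℕ) : ∀ (M : Matroid α) [M.Finite],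
    (∀ e ∈ M.E, ∃ A ⊆ M.E \ {e}, e ∉ M.closure A ∧ e ∉ M.closure ((M.E \ {e}) \ A)) →
    M.E.encard = M.eRank + d →
    {C : Set α | M.IsCircuit C ∧ C.ncard = 4}.ncard ≤ gbR d (M.E \ M.coloops).ncard := by
  induction d with
  | zero =>
    intro M _ hfree hd
    rw [gbR_of_le_four (by norm_num)]
    exact ThmN.ncard_fourCircuits_le_avgChain16 0 M hfree hd
  | succ d ih =>
    intro M _ hfree hd
    rcases Nat.lt_or_ge d 4 with hd4 | hd4
    · rw [gbR_of_le_four (by omega)]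
      exact ThmN.ncard_fourCircuits_le_avgChain16 (d + 1) M hfree hd
    obtain ⟨d', rfl⟩ : ∃ d', d = d' + 4 := ⟨d - 4, by omega⟩
    rw [show d' + 4 + 1 = d' + 5 by ring] at hd ⊢
    rw [gbR_succ]
    split_ifs with hn9
    · exact ncard_fourCircuits_le_gb (d' + 5) M hfree hd _ le_rfl
    classical
    -- the coloop-free part `P`
    set P := M ＼ M.coloops with hPdef
    have hPcol : P.coloops = ∅ := coloops_delete_coloops M
    have hPfree := hfree_delete_set M hfree M.coloops
    have hPd : P.E.encard = P.eRank + ((d' + 5 : ℕ) : ℕ∞) := encard_delete_coloops M hd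
    have hPd' : P.E.encard = P.eRank + ((d' + 4 : ℕ) + 1) := by rw [hPd]; push_cast; ring
    have hPs : {C : Set α | P.IsCircuit C ∧ C.ncard = 4} = {C : Set α | M.IsCircuit C ∧ C.ncard = 4} :=
      fourCircuits_delete_coloops M
    have hPn : P.E.ncard = (M.E \ M.coloops).ncard := ncard_ground_delete_coloops M
    -- the exact point count `n`
    set n := (M.E \ M.coloops).ncard with hn
    have hn9 : 9 ≤ n := by omega
    have hPnn : P.E.ncard = n := hPn
    rw [← hPs]
    by_cases hA : ∃ e ∈ P.E, 3 ≤ (P ＼ {e}).coloops.ncard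
    · -- CASE A: a point with `≥ 3` series partners lies on at most one quad
      obtain ⟨e, heE, hk3⟩ := hA
      have hec : ¬ P.IsColoop e := by
        rw [Matroid.isColoop_iff_mem_coloops, hPcol]; exact Set.notMem_empty e
      have hthr : {C : Set α | P.IsCircuit C ∧ C.ncard = 4 ∧ e ∈ C}.ncard ≤ 1 := by
        rcases Nat.lt_or_ge (P ＼ {e}).coloops.ncard 4 with hk4 | hk4
        · exact S2.ncard_fourCircuitsThrough_le_one_of_three P hPcol e (by omega)
        · rw [S2.ncard_fourCircuitsThrough_eq_zero_of_four_le P hPcol e hk4]; norm_num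
      have hsplit := ncard_fourCircuits_le_through_add_delete P e
      have hde : (P ＼ {e}).E.encard = (P ＼ {e}).eRank + ((d' + 4 : ℕ) : ℕ∞) :=
        S2.delete_nullity_of_nonColoop' P hPd' heE hec
      have hrec := ThmN.ncard_fourCircuits_le_avgChain16 (d' + 4) (P ＼ {e}) (hfree_delete P hPfree e) hde
      exact le_max_of_le_left (le_max_of_le_left (by omega))
    · -- CASE B: every point has `≤ 2` series partners — the averaged point `x`
      push Not at hA
      rcases Nat.eq_zero_or_pos {C : Set α | P.IsCircuit C ∧ C.ncard = 4}.ncard with h0 | hpos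
      · rw [h0]; exact Nat.zero_le _
      obtain ⟨x, hxE, -, hx⟩ := exists_nonColoop_ncard_fourCircuitsThrough_le P hpos
      have hmn : (P.ground_finite.toFinset.filter (fun y => ¬ P.IsColoop y)).card = P.E.ncard := by
        rw [Finset.filter_true_of_mem, ← Set.ncard_eq_toFinset_card _ P.ground_finite]
        intro y _
        rw [Matroid.isColoop_iff_mem_coloops, hPcol]
        exact Set.notMem_empty y
      rw [hmn, hPnn] at hx
      -- `P ＼ {x}`: a core of nullity `d' + 4` with `≥ n' − 3` non-coloops
      have hxc : ¬ P.IsColoop x := by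
        rw [Matroid.isColoop_iff_mem_coloops, hPcol]; exact Set.notMem_empty x
      have hdx : (P ＼ {x}).E.encard = (P ＼ {x}).eRank + ((d' + 4 : ℕ) : ℕ∞) :=
        S2.delete_nullity_of_nonColoop' P hPd' hxE hxc
      have hk2 : (P ＼ {x}).coloops.ncard ≤ 2 := by have := hA x hxE; omega
      have hxn : (P ＼ {x}).E.ncard + 1 = P.E.ncard := by
        rw [_root_.Matroid.delete_ground]
        exact Set.ncard_sdiff_singleton_add_one hxE P.ground_finite
      set k := (P ＼ {x}).coloops.ncard with hk
      have hnc : ((P ＼ {x}).E \ (P ＼ {x}).coloops).ncard = n - 1 - k := by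
        have hKsub : (P ＼ {x}).coloops ⊆ (P ＼ {x}).E := (P ＼ {x}).coloops_subset_ground
        rw [Set.ncard_sdiff hKsub ((P ＼ {x}).ground_finite.subset hKsub)]
        omega
      have hrec := ih (P ＼ {x}) (hfree_delete P hPfree x) hdx
      rw [hnc] at hrec
      have hsplit := ncard_fourCircuits_le_through_add_delete P x
      have hxc' : x ∈ P.E := hxE
      rcases (show k = 0 ∨ k = 1 ∨ k = 2 by omega) with h0 | h1 | h2
      · -- no series partner: `P ＼ x` is coloop-free on `n − 1` points
        rw [h0, Nat.sub_zero] at hrec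
        have hsub : {C : Set α | P.IsCircuit C ∧ C.ncard = 4}.ncard -
            4 * {C : Set α | P.IsCircuit C ∧ C.ncard = 4}.ncard / n ≤ gbR (d' + 4) (n - 1) := by omega
        exact le_max_of_le_left (le_max_of_le_right (le_mul_div_of_sub_div_le (by omega) hsub))
      · -- one series partner: the coloop-free part of `P ＼ x` has `n − 2` points
        rw [h1, show n - 1 - 1 = n - 2 by omega] at hrec
        have hsub : {C : Set α | P.IsCircuit C ∧ C.ncard = 4}.ncard -
            4 * {C : Set α | P.IsCircuit C ∧ C.ncard = 4}.ncard / n ≤ gbR (d' + 4) (n - 2) := by omega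
        exact le_max_of_le_right (le_max_of_le_left (le_mul_div_of_sub_div_le (by omega) hsub))
      · -- two series partners `y, z`: every quad through `x` is `{x, y, z, w}`
        rw [h2, show n - 1 - 2 = n - 3 by omega] at hrec
        have hthr := ncard_fourCircuitsThrough_le_of_two P hPcol x hxc' h2
        rw [hPnn] at hthr
        exact le_max_of_le_right (le_max_of_le_right (by omega))


/-- **The coloop-free form**: on a coloop-free `e`-free core of nullity `d` on `n` points, `s₄ ≤ gbR d n`. -/
theorem ncard_fourCircuits_le_gbR_of_coloopFree (M : Matroid α) [M.Finite]
    (hfree : ∀ e ∈ M.E, ∃ A ⊆ M.E \ {e}, e ∉ M.closure A ∧ e ∉ M.closure ((M.E \ {e}) \ A))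
    {d : ℕ} (hd : M.E.encard = M.eRank + d) (hcol : M.coloops = ∅) {n : ℕ} (hn : M.E.ncard = n) :
    {C : Set α | M.IsCircuit C ∧ C.ncard = 4}.ncard ≤ gbR d n := by
  have h := ncard_fourCircuits_le_gbR d M hfree hd
  rwa [hcol, Set.sdiff_empty, hn] at h

end S1

end PercRepro
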